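import Summits.MatrixMultiplication.OmegaCensus.STPPSmallPatternT1Below24
import Summits.MatrixMultiplication.OmegaCensus.STPP222CubeNoneBelow32

/-!
# ω-census, small STPP pattern `(2,1,1)^k`: the structure-theorem bridge for NONE sides in an order window `≤ 45`

HONEST FRAMING (pub-omega census; verbatim): lottery ticket; floor = certified bounds/negative ranges.
Census STRUCTURE bookkeeping of the STPP track (seat pub-omega-eng2 = ENG2, gen 33; STRUCTURE row B5, the threshold column
`T1(H) = max {k : (2,1,1)^k ⊆ H}` — the lower sides of its ORDER LAWS, e.g. `(2,1,1)⁶ ⊆ G ↔ 30 ≤ |G|` whose NONE side is the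
twelve abelian groups of order `24 … 29`), not progress on `ω`: small patterns in small groups bound no exponent.

`STPPSmallPatternT1Below24.lean` (stpp-3) bridges kernel cells to ALL finite abelian groups of order `≤ 23` (`capList26`,
`ppList23`); the `k ≥ 6` lower sides live in the window `24 … 45`, so this file restates the two bridge steps over stpp-2's
`ppList`/`capList`/`le_capMS_of_prod_le45` (`STPP222CubeFrom46.lean`, `STPP222CubeNoneBelow32.lean`), generic in the pattern
length `k` and the order window `[lo, hi]`, `hi ≤ 45`:

* `not_exists_isSTPP_211_pi45` — the product case `Π i, ℤ/(pᵢ^{eᵢ})`: a kernel domination core (`hcore`: every capped multiset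
  of prime powers with product in `[lo, hi]` is matched, with equal product, by a listed moduli list) plus the exclusions of the
  listed seed groups (`hnone`) exclude `(2,1,1)^k`;
* `not_exists_isSTPP_211_of_card_window45` — the structure-theorem step: every finite abelian `G` with `lo ≤ |G| ≤ hi`.

References: H. Cohn, R. Kleinberg, B. Szegedy, C. Umans, FOCS 2005 (arXiv:math/0511460), Def. 5.1.
-/

open Literature.Computability.AlgebraicComplexity Finset

namespace Summit.MatrixMultiplication.OmegaCensus

/-- **The product case, window `[lo, hi]`, `hi ≤ 45`.**  If every multiset of prime powers (each dividing some `1 ≤ E ≤ hi`)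
with product in `[lo, hi]` is matched (domination with equal product, a kernel decision supplied as `hcore`) by a list of moduli
whose seed group admits no `(2,1,1)^k` (`hnone`), then no `Π i, ℤ/(pᵢ^{eᵢ})` with `lo ≤ ∏ pᵢ^{eᵢ} ≤ hi` and all
`pᵢ^{eᵢ} ∣ E` admits `(2,1,1)^k`. [cite: CohnKleinbergSzegedyUmans2005, Def. 5.1] -/
theorem not_exists_isSTPP_211_pi45 {k lo hi : ℕ} (hhi : hi ≤ 45) {L : List (List ℕ)}
    (hcore : ∀ E ∈ List.range' 1 hi, ∀ M ∈ subMS (capList E), lo ≤ M.prod → M.prod ≤ hi →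
      ∃ s ∈ L, dom s M = true ∧ s.prod = M.prod)
    (hnone : ∀ s ∈ L, ¬ ∃ A B C : Fin k → Finset (SeedType s), IsSTPP A B C ∧
      ∀ i, (A i).card = 2 ∧ (B i).card = 1 ∧ (C i).card = 1)
    {ι : Type} [Fintype ι] [DecidableEq ι] (p e : ι → ℕ) (hp : ∀ i, (p i).Prime)
    {E : ℕ} (hE1 : 1 ≤ E) (hEhi : E ≤ hi) (hdvd : ∀ i, p i ^ e i ∣ E) (hlo : lo ≤ ∏ i, p i ^ e i)
    (hle : ∏ i, p i ^ e i ≤ hi) :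
    ¬ ∃ A B C : Fin k → Finset (Π i, ZMod (p i ^ e i)), IsSTPP A B C ∧
      ∀ i, (A i).card = 2 ∧ (B i).card = 1 ∧ (C i).card = 1 := by
  have hq0 : ∀ i, p i ^ e i ≠ 0 := fun i => pow_ne_zero _ (hp i).ne_zero
  haveI : ∀ i, NeZero (p i ^ e i) := fun i => ⟨hq0 i⟩
  set M : Multiset ℕ := (Finset.univ.filter fun i => 0 < e i).val.map fun i => p i ^ e i with hM
  have hprodeq : M.prod = ∏ i, p i ^ e i := by
    rw [hM, ← Finset.prod_eq_multiset_prod]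
    exact Finset.prod_filter_of_ne fun i _ hi => Nat.pos_of_ne_zero fun h0 => hi (by rw [h0, pow_zero])
  have hmem : ∀ a ∈ M, a ∈ ppList ∧ a ∣ E := by
    intro a ha
    obtain ⟨i, hi, rfl⟩ := Multiset.mem_map.1 ha
    have hi' : 0 < e i := (Finset.mem_filter.1 hi).2
    exact ⟨pow_mem_ppList (hp i) hi' (le_trans (Nat.le_of_dvd (by omega) (hdvd i)) (by omega)), hdvd i⟩
  have hEI : E ∈ List.range' 1 hi := List.mem_range'_1.2 ⟨hE1, by omega⟩
  have hEI45 : E ∈ List.range' 1 45 := List.mem_range'_1.2 ⟨hE1, by omega⟩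
  have hcap : M ≤ capMS (capList E) :=
    le_capMS_of_prod_le45 hEI45 (fun a ha => (hmem a ha).1) (fun a ha => (hmem a ha).2) (by rw [hprodeq]; omega)
  obtain ⟨s, hs, hD, hsprod⟩ := hcore E hEI M (mem_subMS_of_le _ _ hcap) (by rw [hprodeq]; exact hlo)
    (by rw [hprodeq]; exact hle)
  obtain ⟨φ, hφ, -⟩ := exists_emb_of_dom (fun i => p i ^ e i) hq0 s _ hD
  have hcard : Nat.card (SeedType s) = Nat.card (Π i, ZMod (p i ^ e i)) := by
    rw [card_seedType, hsprod, hprodeq, Nat.card_pi]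
    simp
  exact not_exists_isSTPP_211_of_card_eq φ hφ hcard (hnone s hs)

/-- **The structure-theorem step, window `[lo, hi]`, `hi ≤ 45`.**  Under the hypotheses of `not_exists_isSTPP_211_pi45`, no
finite abelian group `G` with `lo ≤ |G| ≤ hi` admits `(2,1,1)^k`. [cite: CohnKleinbergSzegedyUmans2005, Def. 5.1] -/
theorem not_exists_isSTPP_211_of_card_window45 {k lo hi : ℕ} (hhi : hi ≤ 45) {L : List (List ℕ)}
    (hcore : ∀ E ∈ List.range' 1 hi, ∀ M ∈ subMS (capList E), lo ≤ M.prod → M.prod ≤ hi →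
      ∃ s ∈ L, dom s M = true ∧ s.prod = M.prod)
    (hnone : ∀ s ∈ L, ¬ ∃ A B C : Fin k → Finset (SeedType s), IsSTPP A B C ∧
      ∀ i, (A i).card = 2 ∧ (B i).card = 1 ∧ (C i).card = 1)
    {G : Type*} [AddCommGroup G] [Finite G] (hlo : lo ≤ Nat.card G) (hG : Nat.card G ≤ hi) :
    ¬ ∃ A B C : Fin k → Finset G, IsSTPP A B C ∧ ∀ i, (A i).card = 2 ∧ (B i).card = 1 ∧ (C i).card = 1 := by
  classical
  rintro ⟨A, B, C, hS, hc⟩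
  obtain ⟨ι, _, p, hp, e, ⟨g⟩⟩ := AddCommGroup.equiv_directSum_zmod_of_finite G
  let f : G ≃+ (Π i, ZMod (p i ^ e i)) :=
    g.trans (DirectSum.linearEquivFunOnFintype ℕ ι (fun i => ZMod (p i ^ e i))).toAddEquiv
  have hE1 : 1 ≤ AddMonoid.exponent G := Nat.pos_of_ne_zero AddMonoid.exponent_ne_zero_of_finite
  have hEle : AddMonoid.exponent G ≤ hi :=
    le_trans (Nat.le_of_dvd Nat.card_pos AddGroup.exponent_dvd_nat_card) hG
  have hdvd : ∀ i, p i ^ e i ∣ AddMonoid.exponent G := fun i => by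
    have hinj : Function.Injective (AddMonoidHom.single (fun j => ZMod (p j ^ e j)) i) :=
      Pi.single_injective (M := fun j => ZMod (p j ^ e j)) i
    have h1 : addOrderOf (f.symm (AddMonoidHom.single (fun j => ZMod (p j ^ e j)) i 1)) = p i ^ e i := by
      rw [AddEquiv.addOrderOf_eq, addOrderOf_injective _ hinj, ZMod.addOrderOf_one]
    rw [← h1]
    exact AddMonoid.addOrder_dvd_exponent _
  have hcardeq : Nat.card G = ∏ i, p i ^ e i := by
    rw [Nat.card_congr f.toEquiv, Nat.card_pi]
    simp [Nat.card_zmod]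
  have h := not_exists_isSTPP_211_pi45 hhi hcore hnone p e hp hE1 hEle hdvd (by rw [← hcardeq]; exact hlo)
    (by rw [← hcardeq]; exact hG)
  exact h (exists_isSTPP_211_of_injective f.toAddMonoidHom f.injective ⟨A, B, C, hS, hc⟩)

/-- A `(2,1,1)^k` exclusion for `ℤ/a × ℤ/(m n)` (`m`, `n` coprime) read on `SeedType [a, m, n] = ℤ/a × (ℤ/m × ℤ/n)` (Chinese
remainder theorem on the second factor). [cite: CohnKleinbergSzegedyUmans2005, Def. 5.1] -/
theorem not_exists_isSTPP_211_seedTriple {a m n k : ℕ} (h : m.Coprime n)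
    (hneg : ¬ ∃ A B C : Fin k → Finset (ZMod a × ZMod (m * n)), IsSTPP A B C ∧
      ∀ i, (A i).card = 2 ∧ (B i).card = 1 ∧ (C i).card = 1) :
    ¬ ∃ A B C : Fin k → Finset (SeedType [a, m, n]), IsSTPP A B C ∧ ∀ i, (A i).card = 2 ∧ (B i).card = 1 ∧ (C i).card = 1 :=
  fun hex => hneg (exists_isSTPP_211_of_injective
    (AddEquiv.prodCongr (AddEquiv.refl (ZMod a)) (ZMod.chineseRemainder h).symm.toAddEquiv).toAddMonoidHom
    (AddEquiv.prodCongr (AddEquiv.refl (ZMod a)) (ZMod.chineseRemainder h).symm.toAddEquiv).injective hex)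

end Summit.MatrixMultiplication.OmegaCensus
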